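import Mathlib
import Literature.Computability.AlgebraicComplexity.GroupAlgebraTensor
import Literature.RepresentationTheory.FiniteMonoids.InverseMonoidAlgebrasProofs
import Summits.MatrixMultiplication.MatrixMultiplication.Theses.SemilatticeSTPP

/-!
# MatrixMultiplication / SemilatticeSTPP — `RegularMonoidRank`: `R(T_M) ≤ |M|` for Clifford monoids

Route `MatrixMultiplication/SemilatticeSTPP`, item `stmt-MatrixMultiplication-5974` (support):
for a finite commutative monoid `M` in which every element is (von Neumann) regular,
`∀ x ∃ y, x y x = x`, the structure tensor `groupTensor ℂ M` of the monoid algebra `ℂM` in the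
basis `M` has tensor rank at most `|M|`.

Proof (Munn–Ponizovskiĭ / Steinberg 2016, Ch. 9, as recorded in the tree):

1. a commutative monoid with all elements regular is an inverse monoid
   (`isInverseMonoid_of_comm_of_regular`; Steinberg 2016, Thm. 3.2 — regular with commuting
   idempotents);
2. hence `ℂM` is a semisimple ring (`Steinberg2016_9_4_complex_holds`,
   `Literature/RepresentationTheory/FiniteMonoids/InverseMonoidAlgebrasProofs.lean`);
3. Wedderburn–Artin over the algebraically closed field `ℂ` (Mathlib,
   `IsSemisimpleRing.exists_algEquiv_pi_matrix_of_isAlgClosed`) gives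
   `φ : ℂM ≃ₐ[ℂ] ∏ᵢ ℂ^{dᵢ×dᵢ}`; commutativity of `ℂM` forces every `dᵢ = 1`
   (`blockDegree_eq_one_of_comm`: the matrix units `E₀₁`, `E₁₀` of a block of size `≥ 2` do not
   commute), so the block structure tensor `matMulDirectSum ℂ d d d`
   (`structureTensor_blockBasis_eq_matMulDirectSum`) is the unit tensor `⟨r⟩` on the block index
   set (`matMulDirectSum_eq_ite_of_blockDegree_eq_one`), of rank `≤ r = dim ℂM = |M|`
   (`tensorRank_diagonalTensor_le_card`);
4. isomorphic algebras have restriction-equivalent structure tensors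
   (`structureTensor_restrictsTo_of_algEquiv`) and the group tensor is the structure tensor of
   `ℂM` in the basis `M` (`groupTensor_eq_structureTensor_of_monoid`), so
   `R(groupTensor ℂ M) ≤ R(⟨|M|⟩) ≤ |M|` (`TensorRestrictsTo.tensorRank_le`).
-/

noncomputable section

-- the tree's namespace `Summit.MatrixMultiplication.MatrixMultiplication.…` repeats a component by design
set_option linter.dupNamespace false

namespace Summit.MatrixMultiplication.MatrixMultiplication.Theorems

open scoped BigOperators
open Literature.Computability.AlgebraicComplexity
open Literature.RepresentationTheory.FiniteMonoids

/-- **A commutative monoid in which every element is regular is an inverse monoid** (Steinberg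
2016, Thm. 3.2, commutative case): if `x y x = x` then `y' := y x y` satisfies `x y' x = x`,
`y' x y' = y'`, and two such inverses `n, n'` of `m` agree because
`n = n m n = (n m n)(m n') = n m n'` and symmetrically `n' = n' m n`. -/
theorem isInverseMonoid_of_comm_of_regular (M : Type*) [CommMonoid M]
    (h : ∀ x : M, ∃ y : M, x * y * x = x) : IsInverseMonoid M := by
  intro m
  obtain ⟨y, hy⟩ := h m
  have hn'1 : m * (y * m * y) * m = m := by
    calc m * (y * m * y) * m = (m * y * m) * y * m := by simp only [mul_assoc]
      _ = m := by rw [hy, hy]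
  have hn'2 : y * m * y * m * (y * m * y) = y * m * y := by
    calc y * m * y * m * (y * m * y) = y * (m * y * m) * (y * m * y) := by simp only [mul_assoc]
      _ = y * (m * (y * m * y)) := by rw [hy, mul_assoc]
      _ = y * (m * y * m) * y := by simp only [mul_assoc]
      _ = y * m * y := by rw [hy]
  refine ⟨y * m * y, ⟨hn'1, hn'2⟩, ?_⟩
  rintro n ⟨hn1, hn2⟩
  have e1 : n = n * m * (y * m * y) := by
    calc n = n * m * n := hn2.symm
      _ = n * (m * (y * m * y) * m) * n := by rw [hn'1]
      _ = (n * m * n) * m * (y * m * y) := by ac_rfl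
      _ = n * m * (y * m * y) := by rw [hn2]
  have e2 : y * m * y = y * m * y * m * n := by
    calc y * m * y = y * m * y * m * (y * m * y) := hn'2.symm
      _ = y * m * y * (m * n * m) * (y * m * y) := by rw [hn1]
      _ = (y * m * y * m * (y * m * y)) * m * n := by ac_rfl
      _ = y * m * y * m * n := by rw [hn'2]
  calc n = n * m * (y * m * y) := e1
    _ = y * m * y * m * n := by ac_rfl
    _ = y * m * y := e2.symm

/-- The group tensor of a MONOID is the structure tensor of its monoid algebra `K[G]` in the
basis `(g)_{g ∈ G}` (`MonoidAlgebra.basis`: `g ↦ single g 1`, and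
`single x 1 * single y 1 = single (xy) 1`); the tree's `groupTensor_eq_structureTensor` is the
same statement for groups, with the same proof. -/
theorem groupTensor_eq_structureTensor_of_monoid (K : Type*) [CommSemiring K] (G : Type*)
    [Monoid G] [DecidableEq G] :
    structureTensor (MonoidAlgebra.basis G K) = groupTensor K G := by
  funext z x y
  rw [structureTensor_apply, groupTensor_apply, MonoidAlgebra.basis_apply,
    MonoidAlgebra.basis_apply, MonoidAlgebra.single_mul_single, mul_one]
  show (MonoidAlgebra.single (x * y) (1 : K)).coeff z = _
  simp [Finsupp.single_apply]

/-- **Commutative block algebras have `1 × 1` blocks**: if `∏ᵢ ℂ^{dᵢ×dᵢ}` (`dᵢ ≥ 1`) is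
commutative then every `dᵢ = 1` — in a block of size `≥ 2` the matrix units satisfy
`E₀₁ E₁₀ = E₀₀` but `E₁₀ E₀₁ = E₁₁`, whose `(0,0)` coordinates are `1 ≠ 0` (read off the block
structure tensor `matMulDirectSum`). -/
theorem blockDegree_eq_one_of_comm {r : ℕ} {d : Fin r → ℕ} (hd : ∀ i, NeZero (d i))
    (hcomm : ∀ x y : BlockAlgebra ℂ d, x * y = y * x) (i : Fin r) : d i = 1 := by
  by_contra hne
  have h0 : d i ≠ 0 := (hd i).ne
  have h2 : 2 ≤ d i := by omega
  let a : Fin (d i) := ⟨0, by omega⟩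
  let b : Fin (d i) := ⟨1, by omega⟩
  have hab : a ≠ b := by simp [a, b, Fin.ext_iff]
  let X : BlockAlgebra ℂ d := blockBasis ℂ d ⟨i, (a, b)⟩
  let Y : BlockAlgebra ℂ d := blockBasis ℂ d ⟨i, (b, a)⟩
  have hXY : (blockBasis ℂ d).repr (blockBasis ℂ d ⟨i, (a, b)⟩ * blockBasis ℂ d ⟨i, (b, a)⟩)
      ⟨i, (a, a)⟩ = 1 := by
    rw [← structureTensor_apply, structureTensor_blockBasis_eq_matMulDirectSum,
      matMulDirectSum_block]
    simp [matMulTensor]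
  have hYX : (blockBasis ℂ d).repr (blockBasis ℂ d ⟨i, (b, a)⟩ * blockBasis ℂ d ⟨i, (a, b)⟩)
      ⟨i, (a, a)⟩ = 0 := by
    rw [← structureTensor_apply, structureTensor_blockBasis_eq_matMulDirectSum,
      matMulDirectSum_block]
    simp [matMulTensor, hab]
  rw [hcomm, hYX] at hXY
  exact zero_ne_one hXY

/-- With all blocks of size `1`, the block structure tensor `⊕ᵢ ⟨dᵢ,dᵢ,dᵢ⟩ = ⊕ᵢ ⟨1,1,1⟩` is the
unit tensor `⟨r⟩` on the block index set: entry `1` at `(z, z, z)` and `0` elsewhere. -/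
theorem matMulDirectSum_eq_ite_of_blockDegree_eq_one {r : ℕ} {d : Fin r → ℕ}
    (h1 : ∀ i, d i = 1) (z x y : BlockIndex d) :
    matMulDirectSum ℂ d d d z x y = if x = z ∧ y = z then 1 else 0 := by
  have hsub : ∀ i, Subsingleton (Fin (d i)) := fun i => by
    rw [h1 i]
    infer_instance
  obtain ⟨i, u⟩ := z
  obtain ⟨j, a⟩ := x
  obtain ⟨k, c⟩ := y
  by_cases hx : j = i
  · subst hx
    by_cases hy : k = j
    · subst hy
      have ha : a = u := Prod.ext ((hsub _).elim _ _) ((hsub _).elim _ _)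
      have hc : c = u := Prod.ext ((hsub _).elim _ _) ((hsub _).elim _ _)
      have hu : u.2 = u.1 := (hsub _).elim _ _
      rw [ha, hc, matMulDirectSum_block]
      simp [matMulTensor, hu]
    · rw [matMulDirectSum_of_ne ℂ d d d (Or.inr (Ne.symm hy)), if_neg]
      rintro ⟨-, h⟩
      exact hy (congrArg Sigma.fst h)
  · rw [matMulDirectSum_of_ne ℂ d d d (Or.inl (Ne.symm hx)), if_neg]
    rintro ⟨h, -⟩
    exact hx (congrArg Sigma.fst h)

/-- **The unit tensor `⟨n⟩` has rank at most `n`**: on a finite index type `ι`, the tensor with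
entry `1` at `(z, z, z)` and `0` elsewhere is the sum of the `|ι|` triads `e_s ⊗ e_s ⊗ e_s`. -/
theorem tensorRank_diagonalTensor_le_card {K : Type*} [CommSemiring K] {ι : Type*} [Fintype ι]
    [DecidableEq ι] :
    tensorRank (fun z x y : ι => if x = z ∧ y = z then (1 : K) else 0) ≤ Fintype.card ι := by
  refine tensorRank_le_card_of_eq_sum (fun s z => if z = s then (1 : K) else 0)
    (fun s x => if x = s then (1 : K) else 0) (fun s y => if y = s then (1 : K) else 0) ?_
  funext z x y
  rw [Finset.sum_apply, Finset.sum_apply, Finset.sum_apply]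
  simp only [triad_apply]
  rw [Fintype.sum_eq_single z]
  · by_cases hx : x = z <;> by_cases hy : y = z <;> simp [hx, hy]
  · intro s hs
    rw [if_neg (Ne.symm hs), zero_mul, zero_mul]

/-- **`RegularMonoidRank`** (route `SemilatticeSTPP`, item `stmt-MatrixMultiplication-5974`): for
a finite commutative monoid `M` with every element regular (a Clifford / commutative inverse
monoid), `R(groupTensor ℂ M) ≤ |M|` — `ℂM` is semisimple (Munn–Ponizovskiĭ–Oganesyan; Steinberg
2016, Cor. 9.4, `Steinberg2016_9_4_complex_holds`) and commutative, hence `ℂM ≃ₐ[ℂ] ℂ^{|M|}`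
(Wedderburn–Artin over `ℂ` with `1 × 1` blocks), whose structure tensor is the unit tensor
`⟨|M|⟩`; restriction-equivalence of structure tensors of isomorphic algebras
(`structureTensor_restrictsTo_of_algEquiv`) transports the rank bound. -/
theorem regularMonoidRank_proof :
    Summit.MatrixMultiplication.MatrixMultiplication.Theses.SemilatticeSTPP.RegularMonoidRank := by
  intro M _ _ _ hreg
  have hinv : IsInverseMonoid M := isInverseMonoid_of_comm_of_regular M hreg
  haveI : IsSemisimpleRing (MonoidAlgebra ℂ M) := Steinberg2016_9_4_complex_holds M hinv
  haveI : Module.Finite ℂ (MonoidAlgebra ℂ M) :=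
    Module.Finite.of_basis (MonoidAlgebra.basis M ℂ)
  obtain ⟨r, d, hd, ⟨φ⟩⟩ :=
    IsSemisimpleRing.exists_algEquiv_pi_matrix_of_isAlgClosed ℂ (MonoidAlgebra ℂ M)
  -- commutativity of `ℂM` forces `1 × 1` blocks
  have hcomm : ∀ x y : BlockAlgebra ℂ d, x * y = y * x := fun x y => by
    obtain ⟨x', rfl⟩ := φ.surjective x
    obtain ⟨y', rfl⟩ := φ.surjective y
    rw [← map_mul, ← map_mul, mul_comm]
  have h1 : ∀ i, d i = 1 := blockDegree_eq_one_of_comm hd hcomm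
  -- the group tensor is a restriction of the block structure tensor
  have hres : TensorRestrictsTo (matMulDirectSum ℂ d d d) (groupTensor ℂ M) := by
    rw [← groupTensor_eq_structureTensor_of_monoid ℂ M,
      ← structureTensor_blockBasis_eq_matMulDirectSum]
    exact structureTensor_restrictsTo_of_algEquiv (MonoidAlgebra.basis M ℂ) (blockBasis ℂ d) φ
  -- which is the unit tensor on the block index set
  have hdiag : matMulDirectSum ℂ d d d =
      fun z x y : BlockIndex d => if x = z ∧ y = z then (1 : ℂ) else 0 := by
    funext z x y
    exact matMulDirectSum_eq_ite_of_blockDegree_eq_one h1 z x y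
  -- of size `dim ℂM = |M|`
  have hcard : Fintype.card (BlockIndex d) = Fintype.card M := by
    have e1 : Module.finrank ℂ (MonoidAlgebra ℂ M) = Fintype.card M :=
      Module.finrank_eq_card_basis (MonoidAlgebra.basis M ℂ)
    have e2 : Module.finrank ℂ (BlockAlgebra ℂ d) = Fintype.card (BlockIndex d) :=
      Module.finrank_eq_card_basis (blockBasis ℂ d)
    rw [← e2, ← φ.toLinearEquiv.finrank_eq, e1]
  calc tensorRank (groupTensor ℂ M)
      ≤ tensorRank (matMulDirectSum ℂ d d d) := hres.tensorRank_le
    _ = tensorRank (fun z x y : BlockIndex d => if x = z ∧ y = z then (1 : ℂ) else 0) := by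
        rw [hdiag]
    _ ≤ Fintype.card (BlockIndex d) := tensorRank_diagonalTensor_le_card
    _ = Fintype.card M := hcard

end Summit.MatrixMultiplication.MatrixMultiplication.Theorems

end
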